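import Summits.BirchSwinnertonDyer.Rank1Residual.Additive.GordCharLeadingTermConsequences
import Summits.BirchSwinnertonDyer.Rank1Residual.Additive.GordCycLowerBound
import HarnessLib

/-!
# The (G)-cell at analytic rank ONE: the Iwasawa route — Delbourgo 2002 (B) for a height datum,
# Schneider's non-degeneracy, and ONE typed analytic leading term — and the FIRST class-level
# statements on X3♯(G-ord) ∩ {r = 1} (cell `b2b-bsdres`, sub-cell additive-p2, gen 18)

HONEST FRAMING (cell `b2b-bsdres`, run/shared/lean/b2b/bsd-rank1-residual/, verbatim in every
file): the goal of the cell is to DELETE the COMBINATION-SHAPED residual classes of the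
Birch–Swinnerton-Dyer formula for ALL analytic-rank `≤ 1` elliptic curves over `ℚ` — "full BSD
formula for every rank `≤ 1` curve in class `C`" assembled STRICTLY from published theorems — so
that the rank-`≤ 1` remainder becomes exactly the CONSTRUCTION-SHAPED classes, which are TYPED
(missing-input `Prop`s), NOT attempted. This is not "finishing BSD". Sub-cell `additive-p2`
(CLASS-OWNERS row "X3/X4 additive — pot. good ordinary / X3♯(G-ord)"), generation 18: research
route; no claim beyond the stated classes; X3♯(G-ord)/X4♯(G-ord) stay CONSTRUCTION-SHAPED; labels /
census / located gap UNCHANGED; nothing is booked. Three definitions (two typed inputs and one residue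
predicate, nothing asserted) and theorems; named fact consumed: `Delbourgo2002.mainTheorem` (A).

## What and why

At analytic rank ONE the (G)-cell had, before this file: on X4♯(G-ord) ∩ {`ρ̄` onto} the
Kolyvagin–Gross–Zagier route RELATIVE to the lower halves of rank-`0` Heegner twists (additive-p1's
`LowerHalvesSuffice`; gens 14–17 removed its Manin binder), and on X3♯(G-ord) ∩ {`r = 1`} (reducible
`E[p]`: no Kolyvagin) NO class-level statement at all (RESIDUAL-MAP §I O7-ord: "X3(M) ∧ r = 1 have no
class-level statement"; O7-ord is OPEN "until the comparison [Disegni's `p`-adic `L`-function ↔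
Delbourgo's] is written or typed"). This file TYPES the Iwasawa (`p`-adic BSD) route at an additive
potentially good ORDINARY prime and proves its consumer, for BOTH classes and EVERY defect:

* INPUT 1 (PUBLISHED, named fact A): Delbourgo 2002 Theorem (A) — `X(E/ℚ_∞)` is `Λ`-torsion — and
  Theorem (B) — the algebraic leading term `[T^r]f_E · log_p(γ_cyc)^r · #E(ℚ)_{tors}² ∼ ℓ · #Ш[p^∞] · Reg_p · ∏ c_v`
  for the height `⟨,⟩_{p,ℚ}`, exact order `r = rank E(ℚ)` iff `Reg_p ≠ 0 ∧ Ш[p^∞]` finite — in the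
  tree as `Delbourgo2002.mainTheorem` / `Delbourgo2002.LeadingTermClauses W p Dh` (the clauses for a
  GIVEN height datum `Dh`; the fact asserts them for SOME datum; `ℓ ∣ p²`, `ℓ = 1` off the anomalous
  rows — reading note there).
* INPUT 2 (PER-PAIR CERTIFICATE): Schneider's non-degeneracy `SchneiderConjecture Dh` (`Reg_p ≠ 0`;
  in rank one: the `p`-adic height of a generator is non-zero — a finite `p`-adic computation per
  pair, e.g. PARI `ellpadicheight` at the additive prime over the (G)-field; rmap-2 probes j114148 /
  j114204).
* INPUT 3 (TYPED, §0): `CycCharLeadingTermOneAt W p Dh` — "the leading coefficient of a generator of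
  `char_Λ X(E/ℚ_∞)` at `T = 0` is `u · q · Reg_p(Dh)/log_p(γ_cyc)` with `u ∈ ℤ_p^×` and
  `q = L'(E,1)/(Ω_E · Reg_∞(E)) ∈ ℚ`" = [Delbourgo's Main Conjecture (G) as an equality] ∘
  [the analytic `p`-adic BSD leading term in CLASSICAL currency: `p`-adic Gross–Zagier at the additive
  prime (Disegni, Compositio 153 (2017) Thm. B, nearly ordinary `σ_p` — PUBLISHED) ∘ the comparison of
  Disegni's normalisation with Delbourgo's `L_p^{an}` (Petersson vs Néron periods at `p² ∣ N`; NOT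
  written — RESIDUAL-MAP O7-ord) ∘ Gross–Zagier 1986]. Also typed: the upper divisibility alone (`CycLeadingTermOneAt`, Kato-shaped); the LOWER
  divisibility alone, uniformly in the rank, is team n1011's `CycLowerBoundAt W p Dh`
  (`GordCycLowerBound.lean`, seat n1011-p01, landed on top of this generation's fact) — the equality
  implies it (`cycLowerBoundAt_of_cycCharOne`), so their lower-half consumer and converse apply.
* THE RESIDUE PREDICATE `RankOneIwasawaInputAt W p := ∃ Dh, LeadingTermClauses W p Dh ∧
  SchneiderConjecture Dh ∧ CycCharLeadingTermOneAt W p Dh` — discharged (informally) by Delbourgo's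
  `⟨,⟩_{p,ℚ}`: conjunct 1 is PRINTED, conjunct 2 is a CERTIFICATE, conjunct 3 is CONJECTURE ∘ PUB ∘
  (unwritten comparison). This is the kernel form of O7-ord on the (G-ord) half.
* CONSUMER (§1–§2): on the (G)-cell (`Addv ∧ TypeGOrd`, non-CM, `p ≥ 5`, `ord_{s=1} L(E,s) = 1`):
  `RankOneIwasawaInputAt W p` + (A) + GZK + modularity ⟹ `#Ш_an = q'` with
  **`ord_p q' = ord_p #Ш(E) + ord_p ℓ`** — so `Typed.MissingUpperBoundAt W p` on EVERY row,
  `ord_p #Ш ≤ ord_p #Ш_an ≤ ord_p #Ш + 2`, and **`BSD(E,p)` off the anomalous rows**; with the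
  UPPER divisibility alone (sequel file): `Typed.MissingUpperBoundAt` on every row; with the LOWER
  divisibility alone: n1011-p01's `missingLowerBoundAt_of_cycLowerBound`. The two regulators CANCEL (given
  `Reg_p ≠ 0`), exactly as in Perrin-Riou's good ordinary argument.
* §3 CLASS FORMS: X4♯(G-ord) ∩ {`r = 1`} and — NEW — X3♯(G-ord) ∩ {`r = 1`}, every defect, `p ≥ 5`.

What is NOT claimed: none of the typed inputs is asserted; O7-ord's comparison is typed, not written;
the anomalous rows keep the `ℓ`-slack. Labels UNCHANGED; nothing booked.

References: D. Delbourgo, J. Number Theory 95 (2002) Theorem (A), (B) [Delbourgo2002]; D. Delbourgo,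
Compositio Math. 113 (1998) Main Conjecture p. 151 [Delbourgo1998]; D. Disegni, Compositio Math. 153
(2017) Thm. B; B. Perrin-Riou, Invent. Math. 89 (1987) [PerrinRiou1987]; P. Schneider, Invent. Math. 79
(1985) [Schneider1985]; R. L. Miller, LMS J. Comput. Math. 14 (2011) Def. 1.1 [Miller2011LMS].
-/

noncomputable section

open scoped Classical NumberField

open WeierstrassCurve NumberField Literature.NumberTheory.EllipticCurves
  Literature.NumberTheory.EllipticCurves.ModularForms
  Literature.NumberTheory.EllipticCurves.Rank1Residual
  Literature.NumberTheory.EllipticCurves.Rank1Residual.Typed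
  IsDedekindDomain

namespace Summit.BirchSwinnertonDyer.Rank1Residual.Additive

/-! ### §0 The typed inputs at order one, and the residue predicate -/

/-- **The analytic leading term at `T = 0` in CLASSICAL currency, for the GENERATOR — TYPED** (rank-one
shape). For the globally minimal `W = E`, the prime `p` and a `p`-adic height datum `Dh` on `E(ℚ)`:
for the cyclotomic `ℤ_p`-extension `κ` with topological generator `γ` matching the cyclotomic
variable, every dual datum `D` of `Sel_{p^∞}(E/ℚ_∞)` and every generator `f` of `char_Λ X(E/ℚ_∞)`,
`[T¹] f · log_p(γ_cyc) = u · q · Reg_p(E, Dh)` with `u ∈ ℤ_p^×` and `q ∈ ℚ` defined by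
`L^{(r)}(E,1)/r! = q · Ω_E · Reg_∞(E)`. Intended `Dh` = Delbourgo's `⟨,⟩_{p,ℚ}`; then this is
[Main Conjecture (G), Compositio 113 p. 151, as an EQUALITY] ∘ [`p`-adic Gross–Zagier at the additive
prime in Delbourgo's normalisation (Disegni 2017 Thm. B ∘ an unwritten period comparison) ∘
Gross–Zagier]. OPEN; a predicate on `(W, p, Dh)`; nothing asserted.
[cite: Delbourgo1998, Main Conjecture (p. 151) (shape only; nothing asserted)] -/
def CycCharLeadingTermOneAt (W : WeierstrassCurve ℚ) (p : ℕ) [Fact p.Prime]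
    (Dh : PAdicHeightData W p) : Prop :=
  ∀ (κ : ZpExtension ℚ p) (γ : Field.absoluteGaloisGroup ℚ),
    κ.IsCyclotomic → κ.IsTopGenerator γ → IsCyclotomicVariable p γ →
    ∀ (D : W.SelmerDualData κ γ) (f : IwasawaAlgebra p), D.charIdeal = Ideal.span {f} →
      ∃ u : ℤ_[p]ˣ, ∃ q : ℚ,
        W.leadingLCoeff = (q : ℂ) * (W.realPeriodRat : ℂ) * (W.regulator : ℂ) ∧
        ((PowerSeries.coeff 1 f : ℤ_[p]) : ℚ_[p]) * padicLog p (cyclotomicGenerator p) =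
          ((u : ℤ_[p]) : ℚ_[p]) * (q : ℚ_[p]) * padicRegulator Dh

/-- **The UPPER (Euler-system) divisibility at order one, TYPED** (Kato-shaped): SOME `g ∈ char_Λ X`
with `g(0) = 0` and `[T¹] g · log_p(γ_cyc) = u · q · Reg_p(E, Dh)`, `u ∈ ℤ_p^×` — on the defect-2 rows
with `ρ̄` onto this is [Kato 2004 Thm. 17.4 (3) on the `ω^{(p−1)/2}`-component (A124, in the tree)]
∘ [`p`-adic Gross–Zagier at the additive prime ∘ comparison ∘ Gross–Zagier]. OPEN; nothing asserted.
[cite: Kato2004Asterisque, Thm. 17.4 (3) (shape only; nothing asserted)] -/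
def CycLeadingTermOneAt (W : WeierstrassCurve ℚ) (p : ℕ) [Fact p.Prime]
    (Dh : PAdicHeightData W p) : Prop :=
  ∀ (κ : ZpExtension ℚ p) (γ : Field.absoluteGaloisGroup ℚ),
    κ.IsCyclotomic → κ.IsTopGenerator γ → IsCyclotomicVariable p γ →
    ∀ D : W.SelmerDualData κ γ, ∃ g ∈ D.charIdeal, ∃ u : ℤ_[p]ˣ, ∃ q : ℚ,
      W.leadingLCoeff = (q : ℂ) * (W.realPeriodRat : ℂ) * (W.regulator : ℂ) ∧
      PowerSeries.constantCoeff g = 0 ∧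
      ((PowerSeries.coeff 1 g : ℤ_[p]) : ℚ_[p]) * padicLog p (cyclotomicGenerator p) =
        ((u : ℤ_[p]) : ℚ_[p]) * (q : ℚ_[p]) * padicRegulator Dh

/-- **The residue of the Iwasawa route at rank one on the (G)-cell, TYPED as ONE predicate**: some
`p`-adic height datum `Dh` on `E(ℚ)` satisfies (1) Delbourgo 2002 Theorem (B) (`LeadingTermClauses`,
PRINTED for `Dh = ⟨,⟩_{p,ℚ}`), (2) Schneider's non-degeneracy `Reg_p(E, Dh) ≠ 0` (a per-pair
CERTIFICATE), (3) `CycCharLeadingTermOneAt W p Dh` (CONJECTURE ∘ PUBLISHED ∘ unwritten comparison —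
RESIDUAL-MAP O7-ord). Nothing asserted. [cite: Delbourgo2002, Theorem (B) (p. 40) (shape only; nothing asserted)] -/
def RankOneIwasawaInputAt (W : WeierstrassCurve ℚ) (p : ℕ) [Fact p.Prime] : Prop :=
  ∃ Dh : PAdicHeightData W p, Delbourgo2002.LeadingTermClauses W p Dh ∧ SchneiderConjecture Dh ∧
    CycCharLeadingTermOneAt W p Dh

variable {W : WeierstrassCurve ℚ} {p : ℕ} [hp : Fact p.Prime]

omit hp in
/-- Equality at order one ⟹ team n1011's uniform-in-rank LOWER divisibility `CycLowerBoundAt W p Dh`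
(`GordCycLowerBound.lean`, seat n1011-p01) when `rank E(ℚ) = 1` (cofactor = the unit). Bookkeeping —
so every consumer of `CycLowerBoundAt` applies under `CycCharLeadingTermOneAt`.
[cite: Delbourgo1998, Main Conjecture (p. 151)] -/
theorem cycLowerBoundAt_of_cycCharOne [Fact p.Prime] [W.IsElliptic] {Dh : PAdicHeightData W p}
    (hr1 : W.mordellWeilRank = 1) (h : CycCharLeadingTermOneAt W p Dh) : CycLowerBoundAt W p Dh := by
  intro κ γ hκ hγ hγ' D f hf
  obtain ⟨u, q, hLq, h1⟩ := h κ γ hκ hγ hγ' D f hf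
  refine ⟨q, (u : ℤ_[p]), hLq, ?_⟩
  rw [hr1, pow_one]
  exact h1

/-! ### §1 The core at rank one: the two regulators cancel -/

variable (W p) [W.IsElliptic] [W.IsGloballyMinimal]

omit [W.IsGloballyMinimal] in
/-- **Core, data level (rank ONE, the (G)-cell).** Let `E = W` be globally minimal with
`ord_{s=1} L(E,s) = 1`; `κ, γ` the cyclotomic `ℤ_p`-extension with a topological generator matching
the cyclotomic variable, `D` a dual datum of `Sel_{p^∞}(E/ℚ_∞)` with `X` torsion, `f` a generator of
`char_Λ X`, `Dh` a height datum satisfying Delbourgo's Theorem (B) (`hB : LeadingTermClauses W p Dh`)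
and Schneider's non-degeneracy (`hS`), and suppose `[T¹] f · log_p(γ_cyc) = c · q · Reg_p(E, Dh)` with
`L'(E,1) = q · Ω_E · Reg_∞(E)`, `c ∈ ℤ_p`. Then (Gross–Zagier–Kolyvagin: `rank E(ℚ) = 1`, `Ш` finite;
modularity: `L'(E,1) ≠ 0`) `#Ш_an(E) = q' ∈ ℚ`, `q' ≠ 0`, `c ≠ 0`, and
**`ord_p q' + ord_p c = ord_p #Ш(E) + ord_p ℓ`** with `ℓ ∣ p²`, `ℓ = 1` off the anomalous rows — the
regulator `Reg_p(E, Dh) ≠ 0` CANCELS between (B) and the typed identity.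
[cite: Delbourgo2002, Theorem (B) (p. 40)] [cite: PerrinRiou1987, §1 (the shape of the argument)] -/
theorem exists_padicVal_shaAn_rankOne_of_coeff_one_eq
    (hGZK : rank_eq_analyticRank_of_analyticRank_le_one) (hmod : hasEntireLFunction_rat)
    (hr : W.analyticRank = 1)
    {κ : ZpExtension ℚ p} {γ : Field.absoluteGaloisGroup ℚ}
    (hκ : κ.IsCyclotomic) (hγ : κ.IsTopGenerator γ) (hγ' : IsCyclotomicVariable p γ)
    (D : W.SelmerDualData κ γ) (hX : D.IsTorsion) {f : IwasawaAlgebra p}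
    (hf : D.charIdeal = Ideal.span {f})
    {Dh : PAdicHeightData W p} (hB : Delbourgo2002.LeadingTermClauses W p Dh)
    (hS : SchneiderConjecture Dh)
    {q : ℚ} (hLq : W.leadingLCoeff = (q : ℂ) * (W.realPeriodRat : ℂ) * (W.regulator : ℂ))
    {c : ℤ_[p]} (hc1 : ((PowerSeries.coeff 1 f : ℤ_[p]) : ℚ_[p]) * padicLog p (cyclotomicGenerator p) =
      (c : ℚ_[p]) * (q : ℚ_[p]) * padicRegulator Dh) :
    ∃ q' : ℚ, shaAn W = (q' : ℂ) ∧ q' ≠ 0 ∧ c ≠ 0 ∧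
      ∃ ℓ : ℕ, ℓ ∣ p ^ 2 ∧ (Delbourgo2002.ReductionNonAnomalous W p → ℓ = 1) ∧
        padicValRat p q' + ((c : ℤ_[p]) : ℚ_[p]).valuation =
          padicValNat p W.shaOrder + padicValNat p ℓ := by
  classical
  have hpP : p.Prime := hp.out
  -- rank 1: `L'(E,1) ≠ 0`, `rank E(ℚ) = 1`, `Ш` finite
  obtain ⟨hmw, hfin⟩ := hGZK W (by rw [hr])
  have hmw1 : W.mordellWeilRank = 1 := by rw [hmw, hr]
  haveI : Finite W.sha := hfin
  have hfinp : Finite (AddCommGroup.primaryComponent W.sha p) :=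
    Finite.of_injective _ Subtype.val_injective
  haveI : Module.Finite (IwasawaAlgebra p) D.X :=
    SelmerDualData.module_finite_of_isCyclotomic (W := W) (κ := κ) hκ D hγ
  have hLne : W.leadingLCoeff ≠ 0 := W.leadingLCoeff_ne_zero_holds (hmod W)
  have hq0 : q ≠ 0 := by
    rintro rfl
    rw [Rat.cast_zero, zero_mul, zero_mul] at hLq
    exact hLne hLq
  -- Delbourgo 2002 (B) at `r = 1`, for the datum `Dh`
  obtain ⟨u, ℓ, hℓp, hℓ1, heq⟩ := hB.leadingCoeff hκ hγ hγ' D hX hf hS hfinp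
  rw [hmw1, pow_one] at heq
  -- cancel the `p`-adic regulator
  have hReg : padicRegulator Dh ≠ 0 := hS
  have hkey : (c : ℚ_[p]) * (q : ℚ_[p]) * ((W.torsionOrder : ℕ) : ℚ_[p]) ^ 2 =
      ((u : ℤ_[p]) : ℚ_[p]) * (ℓ : ℚ_[p]) *
        ((Nat.card (AddCommGroup.primaryComponent W.sha p) : ℚ_[p]) * (W.tamagawaProduct : ℚ_[p])) := by
    have h1 : (c : ℚ_[p]) * (q : ℚ_[p]) * padicRegulator Dh * (W.torsionOrder : ℚ_[p]) ^ 2 =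
        ((u : ℤ_[p]) : ℚ_[p]) * (ℓ : ℚ_[p]) *
          ((Nat.card (AddCommGroup.primaryComponent W.sha p) : ℚ_[p]) *
            padicRegulator Dh * W.tamagawaProduct) := by
      rw [← hc1, ← heq]
    have h2 : ((c : ℚ_[p]) * (q : ℚ_[p]) * ((W.torsionOrder : ℕ) : ℚ_[p]) ^ 2) * padicRegulator Dh =
        (((u : ℤ_[p]) : ℚ_[p]) * (ℓ : ℚ_[p]) *
          ((Nat.card (AddCommGroup.primaryComponent W.sha p) : ℚ_[p]) * (W.tamagawaProduct : ℚ_[p]))) *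
          padicRegulator Dh := by
      rw [← mul_right_comm _ (padicRegulator Dh), h1]
      ring
    exact mul_right_cancel₀ hReg h2
  -- the arithmetic quantities and their non-vanishing
  have hT0 : W.torsionOrder ≠ 0 := W.torsionOrder_pos_holds.ne'
  have hTam : 0 < W.tamagawaProduct := W.tamagawaProduct_pos_holds
  have hS0 : Nat.card (AddCommGroup.primaryComponent W.sha p) ≠ 0 := Nat.card_pos.ne'
  have hℓ0 : ℓ ≠ 0 := by
    rintro rfl
    exact pow_ne_zero 2 hpP.ne_zero (Nat.eq_zero_of_zero_dvd hℓp)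
  have hsha : padicValNat p (Nat.card (AddCommGroup.primaryComponent W.sha p)) =
      padicValNat p W.shaOrder := by
    unfold WeierstrassCurve.shaOrder
    exact padicValNat_card_addPrimaryComponent p
  obtain ⟨hc0, hval⟩ := padicVal_bookkeeping (p := p) u hq0 hT0 hS0 hTam.ne' hℓ0 hkey
  rw [hsha] at hval
  have hTq : (W.torsionOrder : ℚ) ≠ 0 := by exact_mod_cast hT0
  have hPq : (W.tamagawaProduct : ℚ) ≠ 0 := by exact_mod_cast hTam.ne'
  exact ⟨q * (W.torsionOrder : ℚ) ^ 2 / (W.tamagawaProduct : ℚ),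
    shaAn_eq_of_leadingLCoeff_eq W hLq,
    div_ne_zero (mul_ne_zero hq0 (pow_ne_zero 2 hTq)) hPq, hc0, ℓ, hℓp, hℓ1, hval⟩

/-- **Core from the residue predicate (rank ONE, the (G)-cell, `p ≥ 5`).** `E = W` globally minimal,
non-CM, ADDITIVE and (G)-ORDINARY at `p ≥ 5`, `ord_{s=1} L(E,s) = 1`. Then `RankOneIwasawaInputAt W p`
+ Delbourgo 2002 (A) (`hDel`, torsion) + GZK + modularity ⟹ `#Ш_an(E) = q'` with
**`ord_p q' = ord_p #Ш(E) + ord_p ℓ`**, `ℓ ∣ p²`, `ℓ = 1` off the anomalous rows.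
[cite: Delbourgo2002, Theorem (A), (B) (p. 40)] -/
theorem exists_padicVal_shaAn_rankOne_of_input (hDel : Delbourgo2002.mainTheorem)
    (hGZK : rank_eq_analyticRank_of_analyticRank_le_one) (hmod : hasEntireLFunction_rat)
    (hp5 : 5 ≤ p) (hcm : ¬ W.HasCM) (hadd : Addv W p) (hG : TypeGOrd W p)
    (hr : W.analyticRank = 1) (hIn : RankOneIwasawaInputAt W p) :
    ∃ q' : ℚ, shaAn W = (q' : ℂ) ∧ q' ≠ 0 ∧
      ∃ ℓ : ℕ, ℓ ∣ p ^ 2 ∧ (Delbourgo2002.ReductionNonAnomalous W p → ℓ = 1) ∧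
        padicValRat p q' = padicValNat p W.shaOrder + padicValNat p ℓ := by
  obtain ⟨Dh, hB, hS, hA⟩ := hIn
  obtain ⟨κ, γ, hκ, hγ, hγ', D, f, hf⟩ := exists_cyclotomic_dualData_generator W p
  have hadd' : ¬ W.HasGoodReductionAtPrime p ∧ ¬ W.HasMultiplicativeReductionAtPrime p := hadd
  have hX : D.IsTorsion := Delbourgo2002.mainTheorem.isTorsion hDel hp5 hcm hadd' hG hκ hγ D
  obtain ⟨u, q, hLq, h1⟩ := hA κ γ hκ hγ hγ' D f hf
  obtain ⟨q', hq', hq'0, -, ℓ, hℓp, hℓ1, hval⟩ :=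
    exists_padicVal_shaAn_rankOne_of_coeff_one_eq W p hGZK hmod hr hκ hγ hγ' D hX hf hB hS hLq
      (c := (u : ℤ_[p])) h1
  refine ⟨q', hq', hq'0, ℓ, hℓp, hℓ1, ?_⟩
  rw [valuation_coe_units_eq_zero, add_zero] at hval
  exact hval

/-! ### §2 Consequences on the (G)-cell at rank one (`p ≥ 5`, `E` non-CM) -/

/-- **Rank ONE, (G)-cell: the residue predicate ⟹ the UPPER half `ord_p #Ш(E) ≤ ord_p #Ш_an(E)` on
EVERY row** — NEW at rank one on X3♯(G-ord) (no Kolyvagin there). [cite: Delbourgo2002, Theorem (B) (p. 40)] -/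
theorem missingUpperBoundAt_rankOne_of_input (hDel : Delbourgo2002.mainTheorem)
    (hGZK : rank_eq_analyticRank_of_analyticRank_le_one) (hmod : hasEntireLFunction_rat)
    (hp5 : 5 ≤ p) (hcm : ¬ W.HasCM) (hadd : Addv W p) (hG : TypeGOrd W p)
    (hr : W.analyticRank = 1) (hIn : RankOneIwasawaInputAt W p) : MissingUpperBoundAt W p := by
  obtain ⟨q, hq, -, ℓ, -, -, hval⟩ :=
    exists_padicVal_shaAn_rankOne_of_input W p hDel hGZK hmod hp5 hcm hadd hG hr hIn
  refine ⟨q, hq, ?_⟩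
  have hℓ : (0 : ℤ) ≤ padicValNat p ℓ := by exact_mod_cast Nat.zero_le _
  linarith

/-- **Rank ONE, (G)-cell: the residue predicate ⟹ `ord_p #Ш(E) ≤ ord_p #Ш_an(E) ≤ ord_p #Ш(E) + 2`
on EVERY row.** [cite: Delbourgo2002, Theorem (B) (p. 40)] -/
theorem padicVal_shaAn_bounds_rankOne_of_input (hDel : Delbourgo2002.mainTheorem)
    (hGZK : rank_eq_analyticRank_of_analyticRank_le_one) (hmod : hasEntireLFunction_rat)
    (hp5 : 5 ≤ p) (hcm : ¬ W.HasCM) (hadd : Addv W p) (hG : TypeGOrd W p)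
    (hr : W.analyticRank = 1) (hIn : RankOneIwasawaInputAt W p) :
    ∃ q : ℚ, shaAn W = (q : ℂ) ∧ (padicValNat p W.shaOrder : ℤ) ≤ padicValRat p q ∧
      padicValRat p q ≤ (padicValNat p W.shaOrder : ℤ) + 2 := by
  obtain ⟨q, hq, -, ℓ, hℓp, -, hval⟩ :=
    exists_padicVal_shaAn_rankOne_of_input W p hDel hGZK hmod hp5 hcm hadd hG hr hIn
  refine ⟨q, hq, ?_, ?_⟩
  · have hℓ : (0 : ℤ) ≤ padicValNat p ℓ := by exact_mod_cast Nat.zero_le _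
    linarith
  · have hℓ : (padicValNat p ℓ : ℤ) ≤ 2 := by exact_mod_cast padicValNat_le_two_of_dvd_sq p hℓp
    linarith

/-- **Rank ONE, (G)-cell: the residue predicate ⟹ `BSD(E,p)` OFF the anomalous rows** (`p ≥ 5`,
`E` non-CM; NO image, Tamagawa, Manin or `#Ш_an` hypothesis; every defect).
[cite: Delbourgo2002, Theorem (B) (p. 40)] [cite: Miller2011LMS, Def. 1.1] -/
theorem bsdp_rankOne_of_input_of_nonAnomalous (hDel : Delbourgo2002.mainTheorem)
    (hGZK : rank_eq_analyticRank_of_analyticRank_le_one) (hmod : hasEntireLFunction_rat)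
    (hp5 : 5 ≤ p) (hcm : ¬ W.HasCM) (hadd : Addv W p) (hG : TypeGOrd W p)
    (hr : W.analyticRank = 1) (hIn : RankOneIwasawaInputAt W p)
    (hna : Delbourgo2002.ReductionNonAnomalous W p) : BSDp W p := by
  obtain ⟨q, hq, -, ℓ, -, hℓ1, hval⟩ :=
    exists_padicVal_shaAn_rankOne_of_input W p hDel hGZK hmod hp5 hcm hadd hG hr hIn
  rw [hℓ1 hna, padicValNat_one_right, Nat.cast_zero, add_zero] at hval
  exact bsdp_of_missingPPartAt W p hGZK (by rw [hr]) ⟨q, hq, hval⟩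

end Summit.BirchSwinnertonDyer.Rank1Residual.Additive

end
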